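import Summits.PneNP.PneNP.Theorems.PhaseTwinsConstantFactorTwinsEverywhereDefs
import Mathlib.Algebra.BigOperators.Ring.Finset
import Mathlib.Data.Fintype.BigOperators

/-!
# Route PhaseTwins, support `ConstantFactorTwinsEverywhere` (stmt-PneNP-2726): independent sets of CFI graphs

For a base graph `G` on `Fin v` and the Cai–Fürer–Immerman graphs `CFI(G, T)` (tree: `cfiGraph`):
* a vertex set `I` is independent in `CFI(G, T_τ)` iff it satisfies the gadget constraint and one
  edge constraint per oriented dart (`isIndepSet_cfiGraph_twistSet_iff`), so that
  `Z(CFI(G, T_τ), λ) = Σ_I [gadgetOK] · Π_d [edgeOK d (τ d)] · λ^{|I|}`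
  (`independencePolynomial_cfiGraph_twistSet`);
* THE SIGNED AVERAGE over all twist vectors collapses edge by edge:
  `Σ_τ sgn(τ) Z(CFI(G, T_τ), λ) = Σ_I [gadgetOK I] λ^{|I|} Π_d δ(d, I)` (`signedSum_eq`), with
  `δ(d, I) ∈ {0, ±1}` non-zero only when `I` meets both link pairs over `d` in exactly one vertex;
* THE FLIP at a dart `d₀` (exchange the two links over `d₀`) preserves cardinality and — off the
  gadget of `d₀` — the gadget constraint, and NEGATES `Π_d δ(d, I)` (`prod_delta_flipI`); it moves
  every configuration with `Π_d δ(d, I) ≠ 0` (`flipI_ne_self`).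
-/

namespace Summit.PneNP.PneNP.PhaseTwins.ConstantFactorTwins

-- `Summit.PneNP.PneNP.…` (summit = sub-problem name) trips the duplicate-namespace linter on every declaration.
set_option linter.dupNamespace false

open Finset
open Literature.ModelTheory.FiniteModelTheory
open Literature.Probability.LatticeModels (independencePolynomial)

noncomputable section

variable {v : ℕ} {G : SimpleGraph (Fin v)}

/-- Membership of an edge in the encoded twist set is the bit of its oriented dart. -/
theorem mem_twistSet_iff (τ : ODart G → Bool) (d : ODart G) :
    s(d.1.1.1, d.1.1.2) ∈ twistSet τ ↔ τ d = true := by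
  constructor
  · rintro ⟨d', hd', he⟩
    have : d' = d := by
      obtain ⟨⟨⟨u', w'⟩, h'⟩, hlt'⟩ := d'
      obtain ⟨⟨⟨u, w⟩, h⟩, hlt⟩ := d
      simp only at he hlt hlt'
      rcases Sym2.eq_iff.1 he with ⟨rfl, rfl⟩ | ⟨rfl, rfl⟩
      · rfl
      · exact absurd (hlt.trans hlt') (lt_irrefl _)
    rw [← this]; exact hd'
  · intro h
    exact ⟨d, h, rfl⟩

variable [DecidableRel G.Adj]

/-! ### Independent sets of `CFI(G, T)` -/

/-- A finite vertex set is independent iff no two of its members are adjacent. -/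
theorem isIndepSet_coe_iff (H : SimpleGraph (CFIVertex G)) (I : Finset (CFIVertex G)) :
    H.IsIndepSet (↑I : Set (CFIVertex G)) ↔ ∀ a ∈ I, ∀ b ∈ I, ¬ H.Adj a b := by
  constructor
  · intro h a ha b hb hab
    exact h (Finset.mem_coe.2 ha) (Finset.mem_coe.2 hb) (H.ne_of_adj hab) hab
  · intro h a ha b hb _
    exact h a (Finset.mem_coe.1 ha) b (Finset.mem_coe.1 hb)

/-- Independence in `CFI(G, T)`: the gadget constraint and the link constraints. -/
theorem isIndepSet_cfiGraph_iff (T : Set (Sym2 (Fin v))) [DecidablePred (· ∈ T)]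
    (I : Finset (CFIVertex G)) :
    (cfiGraph G T).IsIndepSet (↑I : Set (CFIVertex G)) ↔
      I ∈ gadgetOK G ∧ ∀ x : CFIDart G × Bool, linkV x ∈ I → linkV (conn G T x) ∉ I := by
  rw [isIndepSet_coe_iff]
  constructor
  · intro h
    refine ⟨fun x hx d c hd hbad => ?_, fun x hx hconn => h _ hx _ hconn (adj_linkV_conn x)⟩
    obtain ⟨u, S⟩ := x
    exact h _ hx _ hd ((adj_midV_linkV u S d c).2 hbad)
  · rintro ⟨hg, hl⟩ a ha b hb hab
    rcases linkV_or_midV a with ⟨x, rfl⟩ | ⟨⟨u, S⟩, rfl⟩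
    · rcases (adj_linkV_iff x b).1 hab with ⟨S, rfl, hc⟩ | rfl
      · exact hg ⟨x.1.1.1, S⟩ hb x.1 x.2 ha ⟨rfl, hc⟩
      · exact hl x ha hb
    · obtain ⟨w, hw, c, rfl, hc⟩ := (adj_midV_iff u S b).1 hab
      exact hg ⟨u, S⟩ ha ⟨(u, w), hw⟩ c hb ⟨rfl, hc⟩

/-- The link constraints, one per oriented dart. -/
theorem forall_conn_iff (T : Set (Sym2 (Fin v))) [DecidablePred (· ∈ T)] (I : Finset (CFIVertex G)) :
    (∀ x : CFIDart G × Bool, linkV x ∈ I → linkV (conn G T x) ∉ I) ↔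
      ∀ d : ODart G, I ∈ edgeOK d.1 (twist T d.1.1.1 d.1.1.2) := by
  constructor
  · intro h d c hc
    exact h (d.1, c) hc
  · intro h x hx hcx
    obtain ⟨d, c⟩ := x
    obtain ⟨⟨u, w⟩, huw⟩ := d
    rcases lt_trichotomy u w with hlt | heq | hgt
    · exact h ⟨⟨(u, w), huw⟩, hlt⟩ c hx hcx
    · exact absurd heq huw.ne
    · -- the reverse dart is oriented; use the constraint for `conn x`
      have key := h ⟨⟨(w, u), huw.symm⟩, hgt⟩ (xor c (twist T u w)) (by
        simpa [conn] using hcx)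
      apply key
      simpa [rev, conn, twist_comm u w, Bool.xor_assoc] using hx

/-- The twist bit of an oriented dart in the encoded twist set. -/
theorem twist_twistSet (τ : ODart G → Bool) (d : ODart G) :
    twist (twistSet τ) d.1.1.1 d.1.1.2 = τ d := by
  unfold twist
  by_cases h : τ d = true
  · rw [decide_eq_true ((mem_twistSet_iff τ d).2 h), h]
  · rw [Bool.not_eq_true] at h
    rw [h, decide_eq_false]
    rw [mem_twistSet_iff, h]; exact Bool.false_ne_true

/-- **Independence in `CFI(G, T_τ)`** as a conjunction of the gadget constraint and one edge
constraint per oriented dart. -/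
theorem isIndepSet_cfiGraph_twistSet_iff (τ : ODart G → Bool) (I : Finset (CFIVertex G)) :
    (cfiGraph G (twistSet τ)).IsIndepSet (↑I : Set (CFIVertex G)) ↔
      I ∈ gadgetOK G ∧ ∀ d : ODart G, I ∈ edgeOK d.1 (τ d) := by
  rw [isIndepSet_cfiGraph_iff, forall_conn_iff]
  simp only [twist_twistSet]

/-! ### The partition function of `CFI(G, T_τ)` as a sum of products -/

open scoped Classical

/-- Indicator of a proposition as a real number. -/
theorem ite_and_eq_mul (P Q : Prop) [Decidable P] [Decidable Q] (x : ℝ) :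
    (if P ∧ Q then x else 0) = (if P then 1 else 0) * (if Q then x else 0) := by
  by_cases hP : P <;> by_cases hQ : Q <;> simp [hP, hQ]

/-- `Z(CFI(G, T_τ), λ) = Σ_I [I ∈ gadgetOK G] · (Π_d [I ∈ edgeOK d (τ d)]) · λ^{|I|}`. -/
theorem independencePolynomial_cfiGraph_twistSet (τ : ODart G → Bool) (lam : ℝ) :
    independencePolynomial (cfiGraph G (twistSet τ)) lam =
      ∑ I : Finset (CFIVertex G), (if I ∈ gadgetOK G then (1 : ℝ) else 0) *
        ((∏ d : ODart G, (if I ∈ edgeOK d.1 (τ d) then (1 : ℝ) else 0)) * lam ^ I.card) := by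
  classical
  unfold independencePolynomial
  refine Finset.sum_congr rfl fun I _ => ?_
  rw [Finset.prod_boole, if_congr (isIndepSet_cfiGraph_twistSet_iff τ I) rfl rfl, ite_and_eq_mul]
  congr 1
  by_cases h : ∀ d : ODart G, I ∈ edgeOK d.1 (τ d)
  · rw [if_pos h, if_pos (fun d _ => h d), one_mul]
  · rw [if_neg h, if_neg (fun h' => h fun d => h' d (mem_univ d)), zero_mul]

omit [DecidableRel G.Adj] in
/-- A signed sum over the two bits. -/
theorem sum_sgn_mul (f : Bool → ℝ) : ∑ b, sgn b * f b = f false - f true := by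
  rw [Fintype.sum_bool]
  have h1 : sgn true = -1 := rfl
  have h2 : sgn false = 1 := rfl
  rw [h1, h2]; ring

/-- The edge constraint read off the four membership bits. -/
theorem edgeOK_iff_eTable (I : Finset (CFIVertex G)) (d : CFIDart G) (t : Bool) :
    I ∈ edgeOK d t ↔ eTable (decide (linkV (d, true) ∈ I)) (decide (linkV (d, false) ∈ I))
      (decide (linkV (rev d, true) ∈ I)) (decide (linkV (rev d, false) ∈ I)) t = true := by
  rw [mem_edgeOK]
  unfold eTable
  cases t <;> simp <;> tauto

/-- `Σ_b sgn(b) [I ∈ edgeOK d b] = δ(d, I)`. -/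
theorem sum_sgn_edgeOK (I : Finset (CFIVertex G)) (d : CFIDart G) :
    ∑ b, sgn b * (if I ∈ edgeOK d b then (1 : ℝ) else 0) = delta I d := by
  rw [sum_sgn_mul, if_congr (edgeOK_iff_eTable I d false) rfl rfl,
    if_congr (edgeOK_iff_eTable I d true) rfl rfl, delta, dTable]
  push_cast
  rfl

/-- **The signed average.** `Σ_τ sgn(τ) Z(CFI(G,T_τ), λ) = Σ_I [I ∈ gadgetOK G] λ^{|I|} Π_d δ(d, I)`. -/
theorem signedSum_eq (lam : ℝ) :
    ∑ τ : ODart G → Bool, (∏ d, sgn (τ d)) * independencePolynomial (cfiGraph G (twistSet τ)) lam =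
      ∑ I : Finset (CFIVertex G), (if I ∈ gadgetOK G then (1 : ℝ) else 0) * lam ^ I.card *
        ∏ d : ODart G, delta I d.1 := by
  have step1 : ∀ τ : ODart G → Bool,
      (∏ d, sgn (τ d)) * independencePolynomial (cfiGraph G (twistSet τ)) lam =
        ∑ I : Finset (CFIVertex G), (if I ∈ gadgetOK G then (1 : ℝ) else 0) * lam ^ I.card *
          ∏ d : ODart G, (sgn (τ d) * (if I ∈ edgeOK d.1 (τ d) then (1 : ℝ) else 0)) := by
    intro τ
    rw [independencePolynomial_cfiGraph_twistSet, Finset.mul_sum]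
    refine Finset.sum_congr rfl fun I _ => ?_
    rw [Finset.prod_mul_distrib]
    ring
  rw [Finset.sum_congr rfl fun τ _ => step1 τ, Finset.sum_comm]
  refine Finset.sum_congr rfl fun I _ => ?_
  rw [← Finset.mul_sum, ← Fintype.prod_sum fun (d : ODart G) (b : Bool) =>
    sgn b * (if I ∈ edgeOK d.1 b then (1 : ℝ) else 0)]
  simp only [sum_sgn_edgeOK]

/-! ### The flip involution: configurations missing a gadget cancel in pairs -/

/-- The flip is an involution on vertices. -/
theorem flipV_flipV (d₀ : CFIDart G) (x : CFIVertex G) : flipV d₀ (flipV d₀ x) = x := by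
  rcases linkV_or_midV x with ⟨⟨d, c⟩, rfl⟩ | ⟨x, rfl⟩
  · rw [flipV_linkV, flipV_linkV]
    by_cases h : d = d₀ <;> simp [h]
  · rfl

/-- The flip is injective on vertices. -/
theorem flipV_injective (d₀ : CFIDart G) : Function.Injective (flipV d₀) :=
  Function.LeftInverse.injective (flipV_flipV d₀)

/-- Membership in a flipped configuration. -/
theorem mem_flipI {d₀ : CFIDart G} {I : Finset (CFIVertex G)} {x : CFIVertex G} :
    x ∈ flipI d₀ I ↔ flipV d₀ x ∈ I := by
  unfold flipI
  constructor
  · rintro h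
    obtain ⟨y, hy, rfl⟩ := Finset.mem_image.1 h
    rwa [flipV_flipV]
  · intro h
    exact Finset.mem_image.2 ⟨_, h, flipV_flipV d₀ x⟩

/-- Middle vertices of a flipped configuration. -/
theorem midV_mem_flipI {d₀ : CFIDart G} {I : Finset (CFIVertex G)} {x : CFIMidIdx G} :
    midV x ∈ flipI d₀ I ↔ midV x ∈ I := by
  rw [mem_flipI, flipV_midV]

/-- Links of a flipped configuration. -/
theorem linkV_mem_flipI {d₀ : CFIDart G} {I : Finset (CFIVertex G)} {d : CFIDart G} {c : Bool} :
    linkV (d, c) ∈ flipI d₀ I ↔ linkV (d, if d = d₀ then !c else c) ∈ I := by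
  rw [mem_flipI, flipV_linkV]

/-- Links off `d₀` are untouched by the flip. -/
theorem linkV_mem_flipI_of_ne {d₀ : CFIDart G} {I : Finset (CFIVertex G)} {d : CFIDart G}
    (h : d ≠ d₀) {c : Bool} : linkV (d, c) ∈ flipI d₀ I ↔ linkV (d, c) ∈ I := by
  rw [linkV_mem_flipI, if_neg h]

/-- Links over `d₀` are exchanged by the flip. -/
theorem linkV_mem_flipI_self {d₀ : CFIDart G} {I : Finset (CFIVertex G)} {c : Bool} :
    linkV (d₀, c) ∈ flipI d₀ I ↔ linkV (d₀, !c) ∈ I := by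
  rw [linkV_mem_flipI, if_pos rfl]

/-- The flip is an involution on configurations. -/
theorem flipI_flipI (d₀ : CFIDart G) (I : Finset (CFIVertex G)) : flipI d₀ (flipI d₀ I) = I := by
  ext x
  rw [mem_flipI, mem_flipI, flipV_flipV]

/-- The flip preserves cardinality. -/
theorem card_flipI (d₀ : CFIDart G) (I : Finset (CFIVertex G)) : (flipI d₀ I).card = I.card :=
  Finset.card_image_of_injective _ (flipV_injective d₀)

/-- The gadget constraint is flip-invariant when the gadget of `d₀` carries no middle vertex of `I`. -/
theorem gadgetOK_flipI {d₀ : CFIDart G} {I : Finset (CFIVertex G)}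
    (hfree : ∀ S, midV ⟨d₀.1.1, S⟩ ∉ I) : flipI d₀ I ∈ gadgetOK G ↔ I ∈ gadgetOK G := by
  -- one direction suffices, by involutivity
  suffices key : ∀ J : Finset (CFIVertex G), (∀ S, midV ⟨d₀.1.1, S⟩ ∉ J) →
      J ∈ gadgetOK G → flipI d₀ J ∈ gadgetOK G by
    refine ⟨fun h => ?_, key I hfree⟩
    have h' := key (flipI d₀ I) (fun S hS => hfree S (midV_mem_flipI.1 hS)) h
    rwa [flipI_flipI] at h'
  intro J hJ hG x hx d c hd
  rw [midV_mem_flipI] at hx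
  rw [linkV_mem_flipI] at hd
  by_cases hdd : d = d₀
  · subst hdd
    rintro ⟨hx1, -⟩
    obtain ⟨u, S⟩ := x
    simp only at hx1
    subst hx1
    exact hJ S hx
  · rw [if_neg hdd] at hd
    exact hG x hx d c hd

/-- Flipping `d₀` changes the sign of `δ` at `d₀` … -/
theorem delta_flipI_self (d₀ : CFIDart G) (I : Finset (CFIVertex G)) :
    delta (flipI d₀ I) d₀ = - delta I d₀ := by
  have hne : rev d₀ ≠ d₀ := rev_ne d₀
  simp only [delta, linkV_mem_flipI_self, linkV_mem_flipI_of_ne hne, Bool.not_true, Bool.not_false]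
  rw [← Int.cast_neg]
  congr 1
  generalize decide (linkV (d₀, true) ∈ I) = a
  generalize decide (linkV (d₀, false) ∈ I) = b
  generalize decide (linkV (rev d₀, true) ∈ I) = c
  generalize decide (linkV (rev d₀, false) ∈ I) = d
  revert a b c d; decide

/-- … and at `rev d₀` … -/
theorem delta_flipI_rev (d₀ : CFIDart G) (I : Finset (CFIVertex G)) :
    delta (flipI d₀ I) (rev d₀) = - delta I (rev d₀) := by
  have hne : rev d₀ ≠ d₀ := rev_ne d₀
  simp only [delta, rev_rev, linkV_mem_flipI_self, linkV_mem_flipI_of_ne hne, Bool.not_true,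
    Bool.not_false]
  rw [← Int.cast_neg]
  congr 1
  generalize decide (linkV (d₀, true) ∈ I) = a
  generalize decide (linkV (d₀, false) ∈ I) = b
  generalize decide (linkV (rev d₀, true) ∈ I) = c
  generalize decide (linkV (rev d₀, false) ∈ I) = d
  revert a b c d; decide

/-- … and nowhere else. -/
theorem delta_flipI_of_ne {d₀ d : CFIDart G} (h1 : d ≠ d₀) (h2 : d ≠ rev d₀) (I : Finset (CFIVertex G)) :
    delta (flipI d₀ I) d = delta I d := by
  have h3 : rev d ≠ d₀ := fun h => h2 (by rw [← h, rev_rev])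
  simp only [delta, linkV_mem_flipI_of_ne h1, linkV_mem_flipI_of_ne h3]

/-- **Flipping negates the product of the `δ`.** -/
theorem prod_delta_flipI (d₀ : CFIDart G) (I : Finset (CFIVertex G)) :
    ∏ d : ODart G, delta (flipI d₀ I) d.1 = - ∏ d : ODart G, delta I d.1 := by
  rw [← Finset.mul_prod_erase _ _ (Finset.mem_univ (orient d₀)),
    ← Finset.mul_prod_erase _ _ (Finset.mem_univ (orient d₀)), ← neg_mul]
  congr 1
  · rcases orient_eq_or d₀ with h | h <;> rw [h]
    · exact delta_flipI_self d₀ I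
    · exact delta_flipI_rev d₀ I
  · refine Finset.prod_congr rfl fun d hd => ?_
    have hne : d ≠ orient d₀ := (Finset.mem_erase.1 hd).1
    apply delta_flipI_of_ne
    · exact fun h => hne (eq_orient_of_oriented (Or.inl h))
    · exact fun h => hne (eq_orient_of_oriented (Or.inr h))

/-- If the product of the `δ` is non-zero, the configuration is transversal at `d₀`, so the flip moves it. -/
theorem flipI_ne_self {d₀ : CFIDart G} {I : Finset (CFIVertex G)}
    (h : ∏ d : ODart G, delta I d.1 ≠ 0) : flipI d₀ I ≠ I := by
  have hδ : delta I (orient d₀).1 ≠ 0 := fun h0 =>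
    h (Finset.prod_eq_zero (Finset.mem_univ (orient d₀)) h0)
  -- transversality at d₀: exactly one of the two links of d₀ lies in I
  have htrans : (linkV (d₀, true) ∈ I) ↔ ¬ (linkV (d₀, false) ∈ I) := by
    have tab : ∀ a b c d : Bool, dTable a b c d ≠ 0 → (a = !b) ∧ (c = !d) := by decide
    have key : decide (linkV (d₀, true) ∈ I) = !decide (linkV (d₀, false) ∈ I) := by
      rcases orient_eq_or d₀ with ho | ho
      · rw [ho] at hδ; unfold delta at hδ
        exact (tab _ _ _ _ (by exact_mod_cast hδ)).1
      · rw [ho] at hδ; unfold delta at hδ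
        simpa only [rev_rev] using (tab _ _ _ _ (by exact_mod_cast hδ)).2
    by_cases hT : linkV (d₀, true) ∈ I <;> by_cases hF : linkV (d₀, false) ∈ I <;>
      simp [hT, hF] at key ⊢
  intro heq
  have h1 : linkV (d₀, true) ∈ flipI d₀ I ↔ linkV (d₀, true) ∈ I := by rw [heq]
  rw [linkV_mem_flipI_self, Bool.not_true] at h1
  by_cases hF : linkV (d₀, false) ∈ I
  · exact htrans.1 (h1.1 hF) hF
  · exact hF (h1.2 (htrans.2 hF))

end

end Summit.PneNP.PneNP.PhaseTwins.ConstantFactorTwins
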